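import Literature.Barriers.ValiantsHypothesis.BDGIL24IsotypicNaturalProofs
import HarnessLib

/-!
# van den Berg–Dutta–Gesmundo–Ikenmeyer–Lysikov 2024, §2.5: `I(C)` is an ideal; monotonicity
# in the measure — PROVED (API)

Theorem-only API for the statement file `BDGIL24IsotypicNaturalProofs.lean` (val-lit row
vdBDGIL24-A): the paper calls `I(C)` "the vanishing ideal of `C`" (§2.5, p.10); in the tree's
rendering `vanishingIdealSeq c kk` (sequences `(Δ_n)` of metapolynomials that, for every
polynomially bounded `r`, vanish on `X_{n,r(n)}` from some `n` on) this file records that it IS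
an ideal of the ring of all sequences (termwise operations): `zero_mem_vanishingIdealSeq`,
`add_mem_vanishingIdealSeq`, `mul_mem_vanishingIdealSeq`, `smul_mem_vanishingIdealSeq`, and
that membership is an "eventually" property (`mem_vanishingIdealSeq_of_eventuallyEq`). It also
records the monotonicity in the measure: `c ≤ c'` on forms ⇒ `X'_{d,r} ⊆ X_{d,r}`
(`slice_subset_slice_of_le`) ⇒ `I(C) ⊆ I(C')` (`vanishingIdealSeq_mono`) ⇒ natural proofs
against `C` are natural proofs against `C'` (`HasAlgebraicNaturalProofs.mono`; e.g. from `cc`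
to formula size, §2.1), and that only the values of `c` on forms matter
(`vanishingIdealSeq_congr`).

No definitions, no new facts (net debt 0); nothing here bears on `VP ≠ VNP`, which is NOT proved.

## References
* [BergEtAl2024] arXiv:2411.03444, §2.1 (invariant measures, p.6), §2.5 (`X_{d,r}`, `I(C)`,
  Def. 2.3, p.9–10); held text `paper:arxiv-2411.03444` p0007, p0010–p0011.
-/

noncomputable section

open MvPolynomial
open Literature.Computability.AlgebraicComplexity Literature.NumberTheory.DiophantineGeometry

namespace Literature.Barriers.ValiantsHypothesis

namespace BergEtAl2024

section VanishingIdealAPI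

variable (c : (k d : ℕ) → MvPolynomial (Fin k) ℂ → ℕ) (kk : ℕ → ℕ)

/-- `0 ∈ I(C)`. [cite: BergEtAl2024, §2.5 (definition of `I(C)`), p.10 (PDF p.11)] -/
theorem zero_mem_vanishingIdealSeq :
    (fun n => (0 : MvPolynomial (DegIdx (Fin (kk n)) n) ℂ)) ∈ vanishingIdealSeq c kk :=
  fun _ _ => ⟨0, fun _ _ _ _ => map_zero _⟩

/-- `I(C)` is closed under addition.
[cite: BergEtAl2024, §2.5 (definition of `I(C)`), p.10 (PDF p.11)] -/
theorem add_mem_vanishingIdealSeq {Δ Δ' : (n : ℕ) → MvPolynomial (DegIdx (Fin (kk n)) n) ℂ}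
    (hΔ : Δ ∈ vanishingIdealSeq c kk) (hΔ' : Δ' ∈ vanishingIdealSeq c kk) :
    (fun n => Δ n + Δ' n) ∈ vanishingIdealSeq c kk := by
  intro r hr
  obtain ⟨n₀, hn₀⟩ := hΔ r hr
  obtain ⟨n₁, hn₁⟩ := hΔ' r hr
  refine ⟨max n₀ n₁, fun n hn f hf => ?_⟩
  change eval (formCoeff n f) (Δ n + Δ' n) = 0
  rw [map_add, hn₀ n ((le_max_left _ _).trans hn) f hf, hn₁ n ((le_max_right _ _).trans hn) f hf,
    add_zero]

/-- **`I(C)` is an ideal** of the ring of all sequences of metapolynomials (termwise product):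
`Θ · Δ ∈ I(C)` for `Δ ∈ I(C)` and ANY sequence `Θ` ("the vanishing ideal of `C`").
[cite: BergEtAl2024, §2.5 (definition of `I(C)`), p.10 (PDF p.11)] -/
theorem mul_mem_vanishingIdealSeq (Θ : (n : ℕ) → MvPolynomial (DegIdx (Fin (kk n)) n) ℂ)
    {Δ : (n : ℕ) → MvPolynomial (DegIdx (Fin (kk n)) n) ℂ} (hΔ : Δ ∈ vanishingIdealSeq c kk) :
    (fun n => Θ n * Δ n) ∈ vanishingIdealSeq c kk := by
  intro r hr
  obtain ⟨n₀, hn₀⟩ := hΔ r hr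
  refine ⟨n₀, fun n hn f hf => ?_⟩
  change eval (formCoeff n f) (Θ n * Δ n) = 0
  rw [map_mul, hn₀ n hn f hf, mul_zero]

/-- `I(C)` is closed under termwise scalars.
[cite: BergEtAl2024, §2.5 (definition of `I(C)`), p.10 (PDF p.11)] -/
theorem smul_mem_vanishingIdealSeq (a : ℕ → ℂ)
    {Δ : (n : ℕ) → MvPolynomial (DegIdx (Fin (kk n)) n) ℂ} (hΔ : Δ ∈ vanishingIdealSeq c kk) :
    (fun n => a n • Δ n) ∈ vanishingIdealSeq c kk := by
  have h := mul_mem_vanishingIdealSeq c kk (fun n => C (a n)) hΔ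
  refine fun r hr => (h r hr).imp fun n₀ hn₀ n hn f hf => ?_
  change eval (formCoeff n f) (a n • Δ n) = 0
  rw [smul_eq_C_mul]
  exact hn₀ n hn f hf

/-- Changing finitely many terms does not affect membership in `I(C)` (an "eventually" notion).
[cite: BergEtAl2024, §2.5 (definition of `I(C)`), p.10 (PDF p.11)] -/
theorem mem_vanishingIdealSeq_of_eventuallyEq
    {Δ Δ' : (n : ℕ) → MvPolynomial (DegIdx (Fin (kk n)) n) ℂ}
    (hΔ : Δ ∈ vanishingIdealSeq c kk) (N : ℕ) (h : ∀ n, N ≤ n → Δ' n = Δ n) :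
    Δ' ∈ vanishingIdealSeq c kk := by
  intro r hr
  obtain ⟨n₀, hn₀⟩ := hΔ r hr
  refine ⟨max n₀ N, fun n hn f hf => ?_⟩
  rw [h n ((le_max_right _ _).trans hn)]
  exact hn₀ n ((le_max_left _ _).trans hn) f hf

variable {c kk}

/-- **Monotonicity in the measure.** If `c ≤ c'` on forms then `X'_{d,r} ⊆ X_{d,r}`, hence
`I(C) ⊆ I(C')`: equations for the smaller class `C` (fewer easy polynomials is the LARGER
measure) — precisely, a larger measure has smaller slices and more equations.
[cite: BergEtAl2024, §2.5 (definitions of `X_{d,r}`, `I(C)`), p.9–10 (PDF p.10–11)] -/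
theorem slice_subset_slice_of_le {c c' : (k d : ℕ) → MvPolynomial (Fin k) ℂ → ℕ}
    (h : ∀ k d f, f.IsHomogeneous d → c k d f ≤ c' k d f) (k d r : ℕ) :
    slice c' k d r ⊆ slice c k d r :=
  fun f hf => ⟨hf.1, (h k d f hf.1).trans hf.2⟩

/-- `I(C) ⊆ I(C')` when `c ≤ c'` on forms. [cite: BergEtAl2024, §2.5, p.9–10 (PDF p.10–11)] -/
theorem vanishingIdealSeq_mono {c c' : (k d : ℕ) → MvPolynomial (Fin k) ℂ → ℕ}
    (h : ∀ k d f, f.IsHomogeneous d → c k d f ≤ c' k d f) (kk : ℕ → ℕ) :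
    vanishingIdealSeq c kk ⊆ vanishingIdealSeq c' kk :=
  fun _ hΔ r hr => (hΔ r hr).imp fun _ hn₀ n hn f hf =>
    hn₀ n hn f (slice_subset_slice_of_le h _ _ _ hf)

/-- **Natural proofs transfer to larger measures**: if `c ≤ c'` on forms and `C` has algebraic
natural proofs, so does `C'` (same witness). E.g. natural proofs against circuit size `cc` are
natural proofs against formula size.
[cite: BergEtAl2024, Def. 2.3 with §2.1 (the measures `cc`, formula size, ABP width), p.6, p.10] -/
theorem HasAlgebraicNaturalProofs.mono {c c' : (k d : ℕ) → MvPolynomial (Fin k) ℂ → ℕ}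
    (h : ∀ k d f, f.IsHomogeneous d → c k d f ≤ c' k d f) (hc : HasAlgebraicNaturalProofs c) :
    HasAlgebraicNaturalProofs c' := by
  obtain ⟨kk, Δ, hI, hV, hne⟩ := hc
  exact ⟨kk, Δ, vanishingIdealSeq_mono h kk hI, hV, hne⟩

/-- Only the values of `c` on forms matter for `I(C)`: measures agreeing on homogeneous
polynomials have the same slices.
[cite: BergEtAl2024, §2.1 ("`c(f)` for homogeneous `f`") and §2.5, p.6, p.9–10] -/
theorem vanishingIdealSeq_congr {c c' : (k d : ℕ) → MvPolynomial (Fin k) ℂ → ℕ}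
    (h : ∀ k d f, f.IsHomogeneous d → c k d f = c' k d f) (kk : ℕ → ℕ) :
    vanishingIdealSeq c kk = vanishingIdealSeq c' kk :=
  Set.Subset.antisymm (vanishingIdealSeq_mono (fun k d f hf => (h k d f hf).le) kk)
    (vanishingIdealSeq_mono (fun k d f hf => (h k d f hf).ge) kk)

end VanishingIdealAPI

end BergEtAl2024

end Literature.Barriers.ValiantsHypothesis

end
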